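import Summits.QuantumFields.BalabanUV.InfraRed.StrongCouplingFluxMoments
import HarnessLib

/-!
# Strong-coupling front, J-SC16k (part 2/3): the flux side `|p|·Y + X` of the test field and its λ-bounds
`Y ≤ (λ m₂ + H/λ)/2`, `X ≤ (λ z_B + Q/λ)/2` —
observatory of the non-perturbative crossover; no mass-gap claim

IR-3 v2 TWO-FRONT CROSSOVER LEDGER, front SC (`β₀`), SU(2), `d = 4`, Wilson normalisation `β_W = 4/g²`.
ABSOLUTE RULE of this package: No internally-minted statement may enter as a cited fact. Every hypothesis is either
kernel-proved in this package or a verbatim quotation of a PUBLISHED theorem with page reference. The manuscript(s)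
under audit are NOT citable for their own disputed steps — they are the thing under adjudication; programme-internal
(2001/route/tribunal) claims are never citable.  Nothing is cited here: every statement below is [folklore] calculus,
kernel-proved.

## What this file is

Leaf (21) of the kernel port of FRONT-SC §3n.  For the flux test field `W(y) = e^{κ y₀}(e + (α y₀ + β) y)` of leaf
(19) (`radialDiv_fluxField`, `norm_fluxField`):
* `fluxRHS_eq`: if `4β + κ e₀ + (5α + κβ) t + κα t² = p (c₀ + c₁ t + c₂ t²)` identically in `t`, then the flux side of
  `abs_integral_lipschitz_mul_inner_le`,  `∫₀¹ (r² ∫ |radialDiv W (r x)| dσ + r³ ∫ ‖W (r x)‖ dσ) dr`,  equals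
  `|p| · Y + X`,   `Y = ∫₀¹ r⁴ ∫ e^{κ r x₀} |c₀ + c₁ r x₀ + c₂ (r x₀)²| dσ dr`,
  `X = ∫₀¹ r³ ∫ e^{κ r x₀} ‖e + (α r x₀ + β)(r x)‖ dσ dr`   (`|r x|² = r²`, `exp_smul_re`);
* `amgm_abs`, `Y_le`, `X_le`: for every `λ > 0`,  `Y ≤ (λ m₂ + H/λ)/2`  and  `X ≤ (λ z_B + Q/λ)/2`  (pointwise AM–GM
  under both integral signs; `m₂ = ∫₀¹ r⁵ ∫ e^{κ r x₀}`, `z_B = ∫₀¹ r³ ∫ e^{κ r x₀}`, `H`, `Q` as in leaf (20)), whence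
  `Y ≤ √m₂ √H` and `X ≤ √z_B √Q` in leaf (22) by leaf (17)'s `le_sqrt_mul_sqrt_of_forall`.

NOT CLAIMED: any number; no mass-gap claim.
-/

noncomputable section

open MeasureTheory Filter Finset Real
open scoped NNReal Quaternion Matrix ComplexConjugate BigOperators Matrix.Norms.Frobenius ContDiff Topology
  RealInnerProductSpace

open Matrix Complex
open Literature.MathematicalPhysics.QuantumLattice (su2Quat quatMatrix quatMatrix_mul quatMatrix_su2Quat norm_su2Quat)
open Literature.MathematicalPhysics.QuantumFieldTheory
open Literature.MathematicalPhysics.QuantumFieldTheory.SUNBakryEmery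
open Literature.MathematicalPhysics.QuantumFieldTheory.Balaban1983to89.StrongCouplingVarianceWindow (qI qJ qK)

namespace Summit.QuantumFields.BalabanUV.InfraRed.StrongCouplingFluxLambda

open Summit.QuantumFields.BalabanUV.InfraRed.StrongCouplingSphereCalculus (radialDiv quatOfMat quatOfMat_coe)
open Summit.QuantumFields.BalabanUV.InfraRed.StrongCouplingFluxField
open Summit.QuantumFields.BalabanUV.InfraRed.StrongCouplingFluxMoments

/-! ## 0. Continuity plumbing (private copies) -/

/-- Continuity of `su2Quat`. [folklore] -/
private theorem cq1 : Continuous fun g : Matrix.specialUnitaryGroup (Fin 2) ℂ => su2Quat g := by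
  have h : Continuous fun g : Matrix.specialUnitaryGroup (Fin 2) ℂ => quatOfMat (g : Matrix (Fin 2) (Fin 2) ℂ) :=
    (LinearMap.continuous_of_finiteDimensional quatOfMat).comp continuous_subtype_val
  simpa only [quatOfMat_coe] using h

/-- Continuity of the coordinate `x₀`. [folklore] -/
private theorem cq2 : Continuous fun g : Matrix.specialUnitaryGroup (Fin 2) ℂ => (su2Quat g).re :=
  Quaternion.continuous_re.comp cq1

/-- Joint continuity plumbing: `(r, g) ↦ x_g`. [folklore] -/
private theorem cp1 : Continuous fun p : ℝ × Matrix.specialUnitaryGroup (Fin 2) ℂ => su2Quat p.2 :=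
  cq1.comp continuous_snd

/-- Joint continuity plumbing: `(r, g) ↦ (x_g)₀`. [folklore] -/
private theorem cp2 : Continuous fun p : ℝ × Matrix.specialUnitaryGroup (Fin 2) ℂ => (su2Quat p.2).re :=
  cq2.comp continuous_snd

/-! ## 1. The flux functional of the test field: `∫₀¹ (r² ∫|radialDiv W| + r³ ∫‖W‖) = |p|·Y + X` -/

/-- `(r • x)₀ = r x₀` and `e^{κ (r•x)₀} = e^{κ r x₀}` (bookkeeping). [folklore] -/
theorem exp_smul_re (κ r : ℝ) (x : ℍ) : Real.exp (κ * (r • x).re) = Real.exp (κ * r * x.re) := by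
  rw [Quaternion.re_smul, smul_eq_mul, mul_assoc]

/-- **The flux functional of `W(y) = e^{κy₀}(e + (αy₀+β)y)` on the unit sphere.**  If the divergence polynomial
factors as `4β + κe₀ + (5α+κβ)t + καt² = p·(c₀ + c₁t + c₂t²)`, then
`∫₀¹ (r² ∫ |radialDiv W(rx)| dσ + r³ ∫ ‖W(rx)‖ dσ) dr = |p|·Y + X` with
`Y = ∫₀¹ r⁴ ∫ e^{κrx₀}|c₀ + c₁rx₀ + c₂r²x₀²| dσ dr` and `X = ∫₀¹ r³ ∫ e^{κrx₀}‖e + (αrx₀+β)·rx‖ dσ dr`. [folklore] -/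
theorem fluxRHS_eq (κ α β p c₀ c₁ c₂ : ℝ) (e : ℍ)
    (hc : ∀ t : ℝ, 4 * β + κ * e.re + (5 * α + κ * β) * t + κ * α * t ^ 2 = p * (c₀ + c₁ * t + c₂ * t ^ 2)) :
    ∫ r in (0:ℝ)..1, (r ^ 2 * ∫ g,
        |radialDiv (fun y : ℍ => Real.exp (κ * y.re) • (e + (α * y.re + β) • y)) (r • su2Quat g)| ∂haarProbability (Matrix.specialUnitaryGroup (Fin 2) ℂ) +
      r ^ 3 * ∫ g,
        ‖Real.exp (κ * (r • su2Quat g).re) • (e + (α * (r • su2Quat g).re + β) • (r • su2Quat g))‖ ∂haarProbability (Matrix.specialUnitaryGroup (Fin 2) ℂ)) =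
    |p| * (∫ r in (0:ℝ)..1, r ^ 4 * ∫ g,
        Real.exp (κ * r * (su2Quat g).re) * |c₀ + c₁ * (r * (su2Quat g).re) + c₂ * (r * (su2Quat g).re) ^ 2| ∂haarProbability (Matrix.specialUnitaryGroup (Fin 2) ℂ)) +
    ∫ r in (0:ℝ)..1, r ^ 3 * ∫ g,
        Real.exp (κ * r * (su2Quat g).re) * ‖e + (α * (r * (su2Quat g).re) + β) • (r • su2Quat g)‖ ∂haarProbability (Matrix.specialUnitaryGroup (Fin 2) ℂ) := by
  have hq1 := cq1
  have hq := cq2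
  have hp1 := cp1
  have hp := cp2
  have h1 : ∀ r : ℝ, (r ^ 2 * ∫ g,
        |radialDiv (fun y : ℍ => Real.exp (κ * y.re) • (e + (α * y.re + β) • y)) (r • su2Quat g)| ∂haarProbability (Matrix.specialUnitaryGroup (Fin 2) ℂ)) =
      |p| * (r ^ 4 * ∫ g,
        Real.exp (κ * r * (su2Quat g).re) * |c₀ + c₁ * (r * (su2Quat g).re) + c₂ * (r * (su2Quat g).re) ^ 2| ∂haarProbability (Matrix.specialUnitaryGroup (Fin 2) ℂ)) := by
    intro r
    have hpt : ∀ g : Matrix.specialUnitaryGroup (Fin 2) ℂ, |radialDiv (fun y : ℍ => Real.exp (κ * y.re) • (e + (α * y.re + β) • y)) (r • su2Quat g)| =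
        (r ^ 2 * |p|) * (Real.exp (κ * r * (su2Quat g).re) * |c₀ + c₁ * (r * (su2Quat g).re) + c₂ * (r * (su2Quat g).re) ^ 2|) := by
      intro g
      rw [radialDiv_fluxField, exp_smul_re, norm_smul, norm_su2Quat, mul_one, Real.norm_eq_abs, sq_abs,
        Quaternion.re_smul, smul_eq_mul, hc, abs_mul, abs_mul, abs_mul, abs_of_nonneg (sq_nonneg r),
        abs_of_pos (Real.exp_pos _)]
      ring
    simp only [hpt]
    rw [integral_const_mul]
    ring
  have h2 : ∀ r : ℝ, (r ^ 3 * ∫ g,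
        ‖Real.exp (κ * (r • su2Quat g).re) • (e + (α * (r • su2Quat g).re + β) • (r • su2Quat g))‖ ∂haarProbability (Matrix.specialUnitaryGroup (Fin 2) ℂ)) =
      r ^ 3 * ∫ g,
        Real.exp (κ * r * (su2Quat g).re) * ‖e + (α * (r * (su2Quat g).re) + β) • (r • su2Quat g)‖ ∂haarProbability (Matrix.specialUnitaryGroup (Fin 2) ℂ) := by
    intro r
    have hpt : ∀ g : Matrix.specialUnitaryGroup (Fin 2) ℂ, ‖Real.exp (κ * (r • su2Quat g).re) • (e + (α * (r • su2Quat g).re + β) • (r • su2Quat g))‖ =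
        Real.exp (κ * r * (su2Quat g).re) * ‖e + (α * (r * (su2Quat g).re) + β) • (r • su2Quat g)‖ := by
      intro g
      rw [norm_smul, Real.norm_eq_abs, abs_of_pos (Real.exp_pos _), exp_smul_re, Quaternion.re_smul, smul_eq_mul]
    simp only [hpt]
  simp only [h1, h2]
  have cY := continuous_integral₂ (F := fun r (g : Matrix.specialUnitaryGroup (Fin 2) ℂ) =>
    Real.exp (κ * r * (su2Quat g).re) * |c₀ + c₁ * (r * (su2Quat g).re) + c₂ * (r * (su2Quat g).re) ^ 2|) (by fun_prop)
  have cX := continuous_integral₂ (F := fun r (g : Matrix.specialUnitaryGroup (Fin 2) ℂ) =>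
    Real.exp (κ * r * (su2Quat g).re) * ‖e + (α * (r * (su2Quat g).re) + β) • (r • su2Quat g)‖) (by fun_prop)
  have iY : IntervalIntegrable (fun r : ℝ => |p| * (r ^ 4 * ∫ g,
      Real.exp (κ * r * (su2Quat g).re) * |c₀ + c₁ * (r * (su2Quat g).re) + c₂ * (r * (su2Quat g).re) ^ 2| ∂haarProbability (Matrix.specialUnitaryGroup (Fin 2) ℂ)))
      volume 0 1 := (continuous_const.mul ((continuous_pow 4).mul cY)).intervalIntegrable 0 1
  have iX : IntervalIntegrable (fun r : ℝ => r ^ 3 * ∫ g,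
      Real.exp (κ * r * (su2Quat g).re) * ‖e + (α * (r * (su2Quat g).re) + β) • (r • su2Quat g)‖ ∂haarProbability (Matrix.specialUnitaryGroup (Fin 2) ℂ))
      volume 0 1 := ((continuous_pow 3).mul cX).intervalIntegrable 0 1
  rw [intervalIntegral.integral_add iY iX, intervalIntegral.integral_const_mul]

/-! ## 2. The λ-trick (pointwise AM–GM) bounds for `Y` and `X` -/

/-- Pointwise weighted AM–GM (the `λ`-trick): for `m, ρ, E ≥ 0` and `λ > 0`,
`m ρ E |a| ≤ (λ (m ρ²) E + m E a²/λ)/2`, since the difference is `m E (λρ − |a|)²/(2λ)`. [folklore] -/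
theorem amgm_abs {m ρ E a l : ℝ} (hm : 0 ≤ m) (hρ : 0 ≤ ρ) (hE : 0 ≤ E) (hl : 0 < l) : m * ρ * E * |a| ≤ (l * (m * ρ ^ 2) * E + m * E * a ^ 2 / l) / 2 := by
  have key : (l * (m * ρ ^ 2) * E + m * E * a ^ 2 / l) / 2 - m * ρ * E * |a| = m * E * (l * ρ - |a|) ^ 2 / (2 * l) := by
    rw [← sq_abs a]; field_simp; ring
  have h : 0 ≤ m * E * (l * ρ - |a|) ^ 2 / (2 * l) :=
    div_nonneg (mul_nonneg (mul_nonneg hm hE) (sq_nonneg _)) (by positivity)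
  have _hρ := hρ
  linarith

/-- **λ-bound for `Y`.**  For every `λ > 0`:
`Y ≤ (λ·m₂ + H/λ)/2`, `H = ∫₀¹ r³ ∫ e^{κrx₀}(c₀ + c₁rx₀ + c₂r²x₀²)² dσ dr` (pointwise `r⁴e|c| ≤ (λr⁵e + r³ec²/λ)/2`).
[folklore] -/
theorem Y_le (κ c₀ c₁ c₂ : ℝ) {l : ℝ} (hl : 0 < l) : ∫ r in (0:ℝ)..1, r ^ 4 * ∫ g,
        Real.exp (κ * r * (su2Quat g).re) * |c₀ + c₁ * (r * (su2Quat g).re) + c₂ * (r * (su2Quat g).re) ^ 2| ∂haarProbability (Matrix.specialUnitaryGroup (Fin 2) ℂ) ≤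
      (l * (∫ r in (0:ℝ)..1, r ^ 5 * ∫ g, Real.exp (κ * r * (su2Quat g).re) ∂haarProbability (Matrix.specialUnitaryGroup (Fin 2) ℂ)) +
        (∫ r in (0:ℝ)..1, r ^ 3 * ∫ g, Real.exp (κ * r * (su2Quat g).re) *
          (c₀ + c₁ * (r * (su2Quat g).re) + c₂ * (r * (su2Quat g).re) ^ 2) ^ 2 ∂haarProbability (Matrix.specialUnitaryGroup (Fin 2) ℂ)) / l) / 2 := by
  have hq := cq2
  have hp := cp2
  have cY := continuous_integral₂ (F := fun r (g : Matrix.specialUnitaryGroup (Fin 2) ℂ) =>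
    Real.exp (κ * r * (su2Quat g).re) * |c₀ + c₁ * (r * (su2Quat g).re) + c₂ * (r * (su2Quat g).re) ^ 2|) (by fun_prop)
  have c0 := continuous_integral₂ (F := fun r (g : Matrix.specialUnitaryGroup (Fin 2) ℂ) => Real.exp (κ * r * (su2Quat g).re)) (by fun_prop)
  have cH := continuous_integral₂ (F := fun r (g : Matrix.specialUnitaryGroup (Fin 2) ℂ) => Real.exp (κ * r * (su2Quat g).re) *
    (c₀ + c₁ * (r * (su2Quat g).re) + c₂ * (r * (su2Quat g).re) ^ 2) ^ 2) (by fun_prop)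
  -- pointwise in `r ∈ [0, 1]`
  have hpt : ∀ r ∈ Set.Icc (0:ℝ) 1, r ^ 4 * ∫ g,
        Real.exp (κ * r * (su2Quat g).re) * |c₀ + c₁ * (r * (su2Quat g).re) + c₂ * (r * (su2Quat g).re) ^ 2| ∂haarProbability (Matrix.specialUnitaryGroup (Fin 2) ℂ) ≤
      (l / 2) * (r ^ 5 * ∫ g, Real.exp (κ * r * (su2Quat g).re) ∂haarProbability (Matrix.specialUnitaryGroup (Fin 2) ℂ)) +
        (1 / (2 * l)) * (r ^ 3 * ∫ g, Real.exp (κ * r * (su2Quat g).re) *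
          (c₀ + c₁ * (r * (su2Quat g).re) + c₂ * (r * (su2Quat g).re) ^ 2) ^ 2 ∂haarProbability (Matrix.specialUnitaryGroup (Fin 2) ℂ)) := by
    intro r hr
    have hr0 : 0 ≤ r := hr.1
    have i0 : Integrable (fun g : Matrix.specialUnitaryGroup (Fin 2) ℂ => r ^ 4 * (Real.exp (κ * r * (su2Quat g).re) *
        |c₀ + c₁ * (r * (su2Quat g).re) + c₂ * (r * (su2Quat g).re) ^ 2|)) (haarProbability (Matrix.specialUnitaryGroup (Fin 2) ℂ)) :=
      integrable_of_continuous_SUN (by fun_prop) _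
    have i1 : Integrable (fun g : Matrix.specialUnitaryGroup (Fin 2) ℂ => (l / 2 * r ^ 5) * Real.exp (κ * r * (su2Quat g).re)) (haarProbability (Matrix.specialUnitaryGroup (Fin 2) ℂ)) :=
      integrable_of_continuous_SUN (by fun_prop) _
    have i2 : Integrable (fun g : Matrix.specialUnitaryGroup (Fin 2) ℂ => (r ^ 3 / (2 * l)) * (Real.exp (κ * r * (su2Quat g).re) *
        (c₀ + c₁ * (r * (su2Quat g).re) + c₂ * (r * (su2Quat g).re) ^ 2) ^ 2)) (haarProbability (Matrix.specialUnitaryGroup (Fin 2) ℂ)) :=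
      integrable_of_continuous_SUN (by fun_prop) _
    have i12 : Integrable (fun g : Matrix.specialUnitaryGroup (Fin 2) ℂ => (l / 2 * r ^ 5) * Real.exp (κ * r * (su2Quat g).re) +
        (r ^ 3 / (2 * l)) * (Real.exp (κ * r * (su2Quat g).re) *
          (c₀ + c₁ * (r * (su2Quat g).re) + c₂ * (r * (su2Quat g).re) ^ 2) ^ 2)) (haarProbability (Matrix.specialUnitaryGroup (Fin 2) ℂ)) := i1.add i2
    rw [← integral_const_mul]
    refine (integral_mono i0 i12 fun g => ?_).trans (le_of_eq ?_)
    · have h := amgm_abs (m := r ^ 3) (ρ := r) (E := Real.exp (κ * r * (su2Quat g).re))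
        (a := c₀ + c₁ * (r * (su2Quat g).re) + c₂ * (r * (su2Quat g).re) ^ 2) (pow_nonneg hr0 3) hr0
        (Real.exp_pos _).le hl
      refine le_trans (le_of_eq (by ring)) (h.trans (le_of_eq ?_))
      ring
    · rw [integral_add i1 i2, integral_const_mul, integral_const_mul]
      ring
  have iF : IntervalIntegrable (fun r : ℝ => r ^ 4 * ∫ g,
      Real.exp (κ * r * (su2Quat g).re) * |c₀ + c₁ * (r * (su2Quat g).re) + c₂ * (r * (su2Quat g).re) ^ 2| ∂haarProbability (Matrix.specialUnitaryGroup (Fin 2) ℂ))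
      volume 0 1 := ((continuous_pow 4).mul cY).intervalIntegrable 0 1
  have iG1 : IntervalIntegrable (fun r : ℝ => (l / 2) * (r ^ 5 * ∫ g, Real.exp (κ * r * (su2Quat g).re) ∂haarProbability (Matrix.specialUnitaryGroup (Fin 2) ℂ)))
      volume 0 1 := (continuous_const.mul ((continuous_pow 5).mul c0)).intervalIntegrable 0 1
  have iG2 : IntervalIntegrable (fun r : ℝ => (1 / (2 * l)) * (r ^ 3 * ∫ g, Real.exp (κ * r * (su2Quat g).re) *
      (c₀ + c₁ * (r * (su2Quat g).re) + c₂ * (r * (su2Quat g).re) ^ 2) ^ 2 ∂haarProbability (Matrix.specialUnitaryGroup (Fin 2) ℂ))) volume 0 1 :=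
    (continuous_const.mul ((continuous_pow 3).mul cH)).intervalIntegrable 0 1
  have iG : IntervalIntegrable (fun r : ℝ => (l / 2) * (r ^ 5 * ∫ g, Real.exp (κ * r * (su2Quat g).re) ∂haarProbability (Matrix.specialUnitaryGroup (Fin 2) ℂ)) +
      (1 / (2 * l)) * (r ^ 3 * ∫ g, Real.exp (κ * r * (su2Quat g).re) *
        (c₀ + c₁ * (r * (su2Quat g).re) + c₂ * (r * (su2Quat g).re) ^ 2) ^ 2 ∂haarProbability (Matrix.specialUnitaryGroup (Fin 2) ℂ))) volume 0 1 := iG1.add iG2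
  refine (intervalIntegral.integral_mono_on zero_le_one iF iG hpt).trans (le_of_eq ?_)
  rw [intervalIntegral.integral_add iG1 iG2, intervalIntegral.integral_const_mul, intervalIntegral.integral_const_mul]
  ring

/-- **λ-bound for `X`.**  For every `λ > 0`: `X ≤ (λ·z_B + Q/λ)/2` with
`Q = ∫₀¹ r³ ∫ e^{κrx₀}‖e + (αrx₀+β)·rx‖² dσ dr` (pointwise `e‖v‖ ≤ (λe + e‖v‖²/λ)/2`). [folklore] -/
theorem X_le (κ α β : ℝ) (e : ℍ) {l : ℝ} (hl : 0 < l) : ∫ r in (0:ℝ)..1, r ^ 3 * ∫ g,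
        Real.exp (κ * r * (su2Quat g).re) * ‖e + (α * (r * (su2Quat g).re) + β) • (r • su2Quat g)‖ ∂haarProbability (Matrix.specialUnitaryGroup (Fin 2) ℂ) ≤
      (l * (∫ r in (0:ℝ)..1, r ^ 3 * ∫ g, Real.exp (κ * r * (su2Quat g).re) ∂haarProbability (Matrix.specialUnitaryGroup (Fin 2) ℂ)) +
        (∫ r in (0:ℝ)..1, r ^ 3 * ∫ g, Real.exp (κ * r * (su2Quat g).re) *
          ‖e + (α * (r * (su2Quat g).re) + β) • (r • su2Quat g)‖ ^ 2 ∂haarProbability (Matrix.specialUnitaryGroup (Fin 2) ℂ)) / l) / 2 := by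
  have hq1 := cq1
  have hq := cq2
  have hp1 := cp1
  have hp := cp2
  have cX := continuous_integral₂ (F := fun r (g : Matrix.specialUnitaryGroup (Fin 2) ℂ) =>
    Real.exp (κ * r * (su2Quat g).re) * ‖e + (α * (r * (su2Quat g).re) + β) • (r • su2Quat g)‖) (by fun_prop)
  have c0 := continuous_integral₂ (F := fun r (g : Matrix.specialUnitaryGroup (Fin 2) ℂ) => Real.exp (κ * r * (su2Quat g).re)) (by fun_prop)
  have cQ := continuous_integral₂ (F := fun r (g : Matrix.specialUnitaryGroup (Fin 2) ℂ) =>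
    Real.exp (κ * r * (su2Quat g).re) * ‖e + (α * (r * (su2Quat g).re) + β) • (r • su2Quat g)‖ ^ 2) (by fun_prop)
  have hpt : ∀ r ∈ Set.Icc (0:ℝ) 1, r ^ 3 * ∫ g,
        Real.exp (κ * r * (su2Quat g).re) * ‖e + (α * (r * (su2Quat g).re) + β) • (r • su2Quat g)‖ ∂haarProbability (Matrix.specialUnitaryGroup (Fin 2) ℂ) ≤
      (l / 2) * (r ^ 3 * ∫ g, Real.exp (κ * r * (su2Quat g).re) ∂haarProbability (Matrix.specialUnitaryGroup (Fin 2) ℂ)) +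
        (1 / (2 * l)) * (r ^ 3 * ∫ g, Real.exp (κ * r * (su2Quat g).re) *
          ‖e + (α * (r * (su2Quat g).re) + β) • (r • su2Quat g)‖ ^ 2 ∂haarProbability (Matrix.specialUnitaryGroup (Fin 2) ℂ)) := by
    intro r hr
    have hr0 : 0 ≤ r := hr.1
    have i0 : Integrable (fun g : Matrix.specialUnitaryGroup (Fin 2) ℂ => r ^ 3 * (Real.exp (κ * r * (su2Quat g).re) *
        ‖e + (α * (r * (su2Quat g).re) + β) • (r • su2Quat g)‖)) (haarProbability (Matrix.specialUnitaryGroup (Fin 2) ℂ)) :=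
      integrable_of_continuous_SUN (by fun_prop) _
    have i1 : Integrable (fun g : Matrix.specialUnitaryGroup (Fin 2) ℂ => (l / 2 * r ^ 3) * Real.exp (κ * r * (su2Quat g).re)) (haarProbability (Matrix.specialUnitaryGroup (Fin 2) ℂ)) :=
      integrable_of_continuous_SUN (by fun_prop) _
    have i2 : Integrable (fun g : Matrix.specialUnitaryGroup (Fin 2) ℂ => (r ^ 3 / (2 * l)) * (Real.exp (κ * r * (su2Quat g).re) *
        ‖e + (α * (r * (su2Quat g).re) + β) • (r • su2Quat g)‖ ^ 2)) (haarProbability (Matrix.specialUnitaryGroup (Fin 2) ℂ)) :=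
      integrable_of_continuous_SUN (by fun_prop) _
    have i12 : Integrable (fun g : Matrix.specialUnitaryGroup (Fin 2) ℂ => (l / 2 * r ^ 3) * Real.exp (κ * r * (su2Quat g).re) +
        (r ^ 3 / (2 * l)) * (Real.exp (κ * r * (su2Quat g).re) *
          ‖e + (α * (r * (su2Quat g).re) + β) • (r • su2Quat g)‖ ^ 2)) (haarProbability (Matrix.specialUnitaryGroup (Fin 2) ℂ)) := i1.add i2
    rw [← integral_const_mul]
    refine (integral_mono i0 i12 fun g => ?_).trans (le_of_eq ?_)
    · have h := amgm_abs (m := r ^ 3) (ρ := 1) (E := Real.exp (κ * r * (su2Quat g).re))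
        (a := ‖e + (α * (r * (su2Quat g).re) + β) • (r • su2Quat g)‖) (pow_nonneg hr0 3) zero_le_one
        (Real.exp_pos _).le hl
      rw [abs_of_nonneg (norm_nonneg _)] at h
      refine le_trans (le_of_eq (by ring)) (h.trans (le_of_eq ?_))
      ring
    · rw [integral_add i1 i2, integral_const_mul, integral_const_mul]
      ring
  have iF : IntervalIntegrable (fun r : ℝ => r ^ 3 * ∫ g,
      Real.exp (κ * r * (su2Quat g).re) * ‖e + (α * (r * (su2Quat g).re) + β) • (r • su2Quat g)‖ ∂haarProbability (Matrix.specialUnitaryGroup (Fin 2) ℂ))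
      volume 0 1 := ((continuous_pow 3).mul cX).intervalIntegrable 0 1
  have iG1 : IntervalIntegrable (fun r : ℝ => (l / 2) * (r ^ 3 * ∫ g, Real.exp (κ * r * (su2Quat g).re) ∂haarProbability (Matrix.specialUnitaryGroup (Fin 2) ℂ)))
      volume 0 1 := (continuous_const.mul ((continuous_pow 3).mul c0)).intervalIntegrable 0 1
  have iG2 : IntervalIntegrable (fun r : ℝ => (1 / (2 * l)) * (r ^ 3 * ∫ g, Real.exp (κ * r * (su2Quat g).re) *
      ‖e + (α * (r * (su2Quat g).re) + β) • (r • su2Quat g)‖ ^ 2 ∂haarProbability (Matrix.specialUnitaryGroup (Fin 2) ℂ))) volume 0 1 :=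
    (continuous_const.mul ((continuous_pow 3).mul cQ)).intervalIntegrable 0 1
  have iG : IntervalIntegrable (fun r : ℝ => (l / 2) * (r ^ 3 * ∫ g, Real.exp (κ * r * (su2Quat g).re) ∂haarProbability (Matrix.specialUnitaryGroup (Fin 2) ℂ)) +
      (1 / (2 * l)) * (r ^ 3 * ∫ g, Real.exp (κ * r * (su2Quat g).re) *
        ‖e + (α * (r * (su2Quat g).re) + β) • (r • su2Quat g)‖ ^ 2 ∂haarProbability (Matrix.specialUnitaryGroup (Fin 2) ℂ))) volume 0 1 := iG1.add iG2
  refine (intervalIntegral.integral_mono_on zero_le_one iF iG hpt).trans (le_of_eq ?_)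
  rw [intervalIntegral.integral_add iG1 iG2, intervalIntegral.integral_const_mul, intervalIntegral.integral_const_mul]
  ring

end Summit.QuantumFields.BalabanUV.InfraRed.StrongCouplingFluxLambda
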